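import Literature.NumberTheory.Automorphic.IsomorphismGraphLieGens
import Mathlib.LinearAlgebra.RootSystem.Finite.Nondegenerate
import Mathlib.Algebra.Category.Grp.Injective
import HarnessLib

/-!
# Determinant characters on weight classes, and the lattice they span
(trunk T-AUTOMORPHIC, G25 AutomorphicL; step 6 of the graph proof of `chevalley_isomorphism_abstract`)

Input of the "central torus" step of the graph proof of the isomorphism theorem (named fact
`chevalley_isomorphism_abstract`, Springer, *Linear Algebraic Groups*, 2nd ed., 9.6.2; graph
method of Humphreys, *Linear Algebraic Groups*, §33). The adjoint action is blind to the centre,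
so to see that the graph group `H ≤ G × G'` contains no central torus `1 × S'` one needs
characters of an overgroup of `H` — determinants on `G`-stable subspaces of the given
representation `V = kⁿ` — and control of the lattice of weights they induce on the maximal torus.
For one pair `(G, T) ≤ GL_n` with root datum `P` (`h : IsRootDatumOf G T P eX eY`) over an
algebraically closed field this file provides (namespace `Literature.NumberTheory.Automorphic`):

* `projDet Π x = det (x Π + 1 - Π)` for an idempotent `Π` (the determinant of `x` on the image of
  `Π` when `x` commutes with `Π`): `projDet_one`, `projDet_mul` (multiplicative on the commutant of
  `Π`), `projDet_exp` (`= 1` on exponentials of nilpotent matrices commuting with `Π`, via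
  `det exp = 1`), `projDet_conj`, `projDet_diagonal`;
* a diagonalising frame `torusFrame hT` of the torus `T` (`exists_conj_le_diagonalSubgroup`), the
  **coordinate weights** `coordWt i ∈ X` (`i : n`; the characters `t ↦ (g t g⁻¹)_{ii}`), which
  generate `X` (`exists_sum_coordWt_eq`, Springer 3.2.3 via `exists_diagChar_eq`), and their
  classes `wtCls i ∈ X ⧸ R₀` modulo a subgroup `R₀ ≤ X` (the root lattice);
* the **class projectors** `classProj i = g⁻¹ · 1_{wtCls = wtCls i} · g` and the determinant
  characters `projDet (classProj i)`: `t ∈ T` commutes with them and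
  `projDet (classProj i) t = χ_{λ_i}(t)` for the **class weight** `classWt i = ∑_{j ∈ [i]} coordWt j`
  (`classProj_torus_comm`, `projDet_classProj_torus`); weight vectors of weights in `R₀`
  commute with them (`classProj_comm_of_mem_weightSpaceGL`: such weights preserve classes);
  hence `projDet (classProj i) ≡ 1` on the images `φ_s(SL₂)` of the root `SL₂`'s
  (`projDet_classProj_rootSL2`, by `Matrix.SL2.transvection_induction` and `u_s(x) = exp (x e_s)`),
  whence **`⟨λ_i, α_s^∨⟩ = 0`** (`pairing_classWt_coroot`);
* **the lattice lemmas**: a functional `X → ℚ` killing the roots and the `λ_i` vanishes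
  (`addMonoidHom_eq_zero_of_forall_classWt`: it is constant on classes, and `λ_i` is a positive
  multiple of a representative modulo `ℤR`); every `x ∈ (R^∨)^⊥` has a non-zero multiple in the
  span `L` of the `λ_i` (`exists_smul_mem_span_classWt`: otherwise `0 ⊕ (x ↦ 1)` on
  `(L + ℤR) ⊕ ℤx` — a direct sum as `ℤR ∩ (R^∨)^⊥ = 0`,
  `RootPairing.eq_zero_of_mem_rootSpan_of_rootForm_self_eq_zero` — extends to `X → ℚ` by the
  injectivity of `ℚ`, `Module.Baer.of_divisible`); and the two-group combination
  `exists_smul_mem_sup_inf` used by the central-torus step.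

Everything is proved; no named fact is introduced. [folklore] throughout (the use made of these
characters is that of the classical proof that the centre of a connected reductive group is seen
by the characters of `G`, Springer 8.1.8, Humphreys §27.5).

## Mathlib

`RootPairing.rootSpan`, `RootPairing.RootForm` (`rootForm_apply_apply`,
`eq_zero_of_mem_rootSpan_of_rootForm_self_eq_zero`), `Submodule.Quotient`, `Module.Baer.of_divisible`,
`Module.Baer.extension_property`, `LinearPMap.mkSpanSingleton'`,
`Matrix.SL2.transvection_induction`, `IsNilpotent.exp`. Nothing here duplicates a Mathlib or
Literature declaration (searched `projDet`, `coordWt`, `classProj`, `wtCls`, `classWt`).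

## References

* [SpringerLAG1998] T. A. Springer, *Linear Algebraic Groups*, 2nd ed. (1998): 2.4.2, 3.2.3,
  8.1.8, Theorem 9.6.2.
* [Humphreys1975] J. E. Humphreys, *Linear Algebraic Groups*, GTM 21 (1975), §27.5, §33.
-/

noncomputable section

open scoped MatrixGroups IsMulCommutative
open Matrix

namespace Literature.NumberTheory.Automorphic

/-! ### Determinants on the image of a projector -/

section ProjDet

variable {k : Type*} [CommRing k] {n : Type*} [Fintype n] [DecidableEq n]

/-- `projDet Π x = det (x Π + (1 - Π))`: for an idempotent `Π` and `x` commuting with `Π` this is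
the determinant of `x` restricted to the image of `Π`. [folklore] -/
def projDet (Q x : Matrix n n k) : k := (x * Q + (1 - Q)).det

/-- `projDet Π 1 = 1`. [folklore] -/
@[simp] lemma projDet_one (Q : Matrix n n k) : projDet Q 1 = 1 := by
  simp [projDet]

/-- The key identity `(x Π + 1 - Π)(y Π + 1 - Π) = x y Π + 1 - Π` for `Π² = Π` and `y Π = Π y`.
[folklore] -/
lemma projArg_mul {Q y : Matrix n n k} (hQ : Q * Q = Q) (hy : y * Q = Q * y) (x : Matrix n n k) :
    (x * Q + (1 - Q)) * (y * Q + (1 - Q)) = x * y * Q + (1 - Q) := by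
  have h1 : Q * (y * Q) = y * Q := by rw [← Matrix.mul_assoc, ← hy, Matrix.mul_assoc, hQ]
  have h2 : Q * (1 - Q) = 0 := by rw [Matrix.mul_sub, Matrix.mul_one, hQ, sub_self]
  have h3 : (1 - Q) * (y * Q) = 0 := by rw [Matrix.sub_mul, Matrix.one_mul, h1, sub_self]
  have h4 : (1 - Q) * (1 - Q) = 1 - Q := by rw [Matrix.sub_mul, Matrix.one_mul, h2, sub_zero]
  rw [Matrix.add_mul, Matrix.mul_add, Matrix.mul_add, Matrix.mul_assoc x Q (y * Q), h1,
    Matrix.mul_assoc x Q (1 - Q), h2, Matrix.mul_zero, add_zero, h3, h4, zero_add, Matrix.mul_assoc]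

/-- **`projDet Π` is multiplicative on the commutant of `Π`.** [folklore] -/
lemma projDet_mul {Q y : Matrix n n k} (hQ : Q * Q = Q) (hy : y * Q = Q * y) (x : Matrix n n k) :
    projDet Q (x * y) = projDet Q x * projDet Q y := by
  rw [projDet, projDet, projDet, ← Matrix.det_mul, projArg_mul hQ hy]

/-- `projDet Π x` is a unit when `x` is invertible and commutes with `Π` (as does `x⁻¹`). [folklore] -/
lemma projDet_mul_projDet_inv {Q : Matrix n n k} (hQ : Q * Q = Q) (g : GL n k)
    (hg : ((g⁻¹ : GL n k) : Matrix n n k) * Q = Q * ((g⁻¹ : GL n k) : Matrix n n k)) :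
    projDet Q (g : Matrix n n k) * projDet Q ((g⁻¹ : GL n k) : Matrix n n k) = 1 := by
  rw [← projDet_mul hQ hg, Units.mul_inv, projDet_one]

/-- `g⁻¹ (g X) = X`. [folklore] -/
lemma coe_inv_mul_cancel_left (g : GL n k) (X : Matrix n n k) :
    ((g⁻¹ : GL n k) : Matrix n n k) * ((g : Matrix n n k) * X) = X := by
  rw [← Matrix.mul_assoc, Units.inv_mul, Matrix.one_mul]

/-- `g (g⁻¹ X) = X`. [folklore] -/
lemma coe_mul_inv_cancel_left (g : GL n k) (X : Matrix n n k) :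
    (g : Matrix n n k) * (((g⁻¹ : GL n k) : Matrix n n k) * X) = X := by
  rw [← Matrix.mul_assoc, Units.mul_inv, Matrix.one_mul]

/-- **Conjugation**: `projDet (g⁻¹ d g) x = projDet d (g x g⁻¹)`. [folklore] -/
lemma projDet_conj (g : GL n k) (d x : Matrix n n k) :
    projDet (((g⁻¹ : GL n k) : Matrix n n k) * d * (g : Matrix n n k)) x =
      projDet d ((g : Matrix n n k) * x * ((g⁻¹ : GL n k) : Matrix n n k)) := by
  have e : x * (((g⁻¹ : GL n k) : Matrix n n k) * d * (g : Matrix n n k)) + (1 - ((g⁻¹ : GL n k) : Matrix n n k) * d * (g : Matrix n n k)) =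
      ((g⁻¹ : GL n k) : Matrix n n k) *
        ((g : Matrix n n k) * x * ((g⁻¹ : GL n k) : Matrix n n k) * d + (1 - d)) * (g : Matrix n n k) := by
    rw [Matrix.mul_add, Matrix.add_mul, Matrix.mul_sub, Matrix.sub_mul, Matrix.mul_one, Units.inv_mul]
    simp only [Matrix.mul_assoc, coe_inv_mul_cancel_left]
  rw [projDet, projDet, e]
  exact Matrix.det_units_conj' g _

/-- **Diagonal case**: for a `0/1` diagonal projector and a diagonal `x`,
`projDet = ∏_{δ j} x_j`. [folklore] -/
lemma projDet_diagonal (δ : n → Prop) [DecidablePred δ] (c : n → k) :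
    projDet (Matrix.diagonal fun j => if δ j then (1 : k) else 0) (Matrix.diagonal c) =
      ∏ j, if δ j then c j else 1 := by
  rw [projDet, Matrix.diagonal_mul_diagonal, ← Matrix.diagonal_one, Matrix.diagonal_sub,
    Matrix.diagonal_add, Matrix.det_diagonal]
  refine Finset.prod_congr rfl fun j _ => ?_
  split_ifs <;> simp

/-- A `0/1` diagonal matrix is idempotent. [folklore] -/
lemma diagonal_indicator_mul_self (δ : n → Prop) [DecidablePred δ] :
    (Matrix.diagonal fun j => if δ j then (1 : k) else 0) * (Matrix.diagonal fun j => if δ j then (1 : k) else 0) =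
      Matrix.diagonal fun j => if δ j then (1 : k) else 0 := by
  rw [Matrix.diagonal_mul_diagonal]
  congr 1
  funext j
  split_ifs <;> simp

/-- `g⁻¹ d g` is idempotent when `d` is. [folklore] -/
lemma conj_mul_self_of (g : GL n k) {d : Matrix n n k} (hd : d * d = d) :
    ((g⁻¹ : GL n k) : Matrix n n k) * d * (g : Matrix n n k) * (((g⁻¹ : GL n k) : Matrix n n k) * d * (g : Matrix n n k)) =
      ((g⁻¹ : GL n k) : Matrix n n k) * d * (g : Matrix n n k) := by
  simp only [Matrix.mul_assoc, coe_mul_inv_cancel_left]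
  rw [← Matrix.mul_assoc d d, hd]

/-- A matrix whose non-zero entries join only indices with equal `δ` commutes with `diagonal δ`.
[folklore] -/
lemma mul_diagonal_comm_of {B : Matrix n n k} {δ : n → k} (h : ∀ j l, B j l ≠ 0 → δ j = δ l) :
    B * Matrix.diagonal δ = Matrix.diagonal δ * B := by
  ext j l
  rw [Matrix.mul_diagonal, Matrix.diagonal_mul]
  by_cases hB : B j l = 0
  · simp [hB]
  · rw [h j l hB, mul_comm]

/-- Transfer of commutation along conjugation: if `g A g⁻¹` commutes with `d` then `A` commutes with
`g⁻¹ d g`. [folklore] -/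
lemma mul_conj_comm_of (g : GL n k) {A d : Matrix n n k}
    (h : (g : Matrix n n k) * A * ((g⁻¹ : GL n k) : Matrix n n k) * d =
      d * ((g : Matrix n n k) * A * ((g⁻¹ : GL n k) : Matrix n n k))) :
    A * (((g⁻¹ : GL n k) : Matrix n n k) * d * (g : Matrix n n k)) = ((g⁻¹ : GL n k) : Matrix n n k) * d * (g : Matrix n n k) * A := by
  have e1 : A * (((g⁻¹ : GL n k) : Matrix n n k) * d * (g : Matrix n n k)) =
      ((g⁻¹ : GL n k) : Matrix n n k) * ((g : Matrix n n k) * A * ((g⁻¹ : GL n k) : Matrix n n k) * d) * (g : Matrix n n k) := by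
    simp only [Matrix.mul_assoc, coe_inv_mul_cancel_left]
  have e2 : ((g⁻¹ : GL n k) : Matrix n n k) * d * (g : Matrix n n k) * A =
      ((g⁻¹ : GL n k) : Matrix n n k) * (d * ((g : Matrix n n k) * A * ((g⁻¹ : GL n k) : Matrix n n k))) * (g : Matrix n n k) := by
    simp only [Matrix.mul_assoc, Units.inv_mul, Matrix.mul_one]
  rw [e1, e2, h]

end ProjDet

variable {k : Type*} [Field k] {n : Type*} [Fintype n] [DecidableEq n]
variable {ι X Y : Type*} [AddCommGroup X] [AddCommGroup Y]
variable {G T : Subgroup (GL n k)}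
variable {P : RootPairing ι ℤ X Y} {eX : Additive ↥(characterLattice T) ≃+ X}

/-! ### Exponentials -/

/-- If `A` commutes with `Π` then so does every `exp (s A)` — indeed every polynomial in `A`; here
for the truncated exponential of a nilpotent matrix. [folklore] -/
lemma exp_smul_comm_of_comm [CharZero k] {Q A : Matrix n n k}
    (hA : IsNilpotent A) (hc : A * Q = Q * A) (s : k) :
    IsNilpotent.exp (s • A) * Q = Q * IsNilpotent.exp (s • A) := by
  obtain ⟨N, hN⟩ := hA
  rw [exp_smul_matrix_eq_sum hN s, Finset.sum_mul, Finset.mul_sum]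
  refine Finset.sum_congr rfl fun i _ => ?_
  have hc' : Commute A Q := hc
  rw [Matrix.smul_mul, Matrix.smul_mul, Matrix.mul_smul, Matrix.mul_smul, (hc'.pow_left i).eq]

/-- **`projDet Π (exp (s A)) = 1`** for a nilpotent `A` commuting with the idempotent `Π`:
`exp (s A) Π + 1 - Π = exp (s A Π)` and `det exp = 1` (`det_exp_smul`). [folklore] -/
theorem projDet_exp [CharZero k] {Q A : Matrix n n k} (hQ : Q * Q = Q)
    (hA : IsNilpotent A) (hc : A * Q = Q * A) (s : k) :
    projDet Q (IsNilpotent.exp (s • A)) = 1 := by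
  obtain ⟨N, hN⟩ := hA
  -- `(A Π)^i = A^i Π` for `i ≥ 1`
  have hpow : ∀ i : ℕ, (A * Q) ^ (i + 1) = A ^ (i + 1) * Q := by
    intro i
    induction i with
    | zero => rw [zero_add, pow_one, pow_one]
    | succ i ih =>
      rw [pow_succ, ih, pow_succ A (i + 1), Matrix.mul_assoc (A ^ (i + 1)) Q (A * Q),
        ← Matrix.mul_assoc Q A Q, ← hc, Matrix.mul_assoc A Q Q, hQ, ← Matrix.mul_assoc (A ^ (i + 1)) A Q]
  have hN' : (A * Q) ^ (N + 1) = 0 := by rw [hpow, pow_succ, hN, Matrix.zero_mul, Matrix.zero_mul]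
  have hN1 : A ^ (N + 1) = 0 := by rw [pow_succ, hN, Matrix.zero_mul]
  have key : IsNilpotent.exp (s • A) * Q + (1 - Q) = IsNilpotent.exp (s • (A * Q)) := by
    rw [exp_smul_matrix_eq_sum hN1 s, exp_smul_matrix_eq_sum hN' s, Finset.sum_range_succ',
      Finset.sum_range_succ']
    simp only [pow_zero, Nat.factorial_zero, Nat.cast_one, inv_one, one_smul, Finset.sum_mul,
      Matrix.add_mul, Matrix.one_mul, Matrix.smul_mul, hpow]
    abel
  rw [projDet, key]
  exact det_exp_smul ⟨N + 1, hN'⟩ s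

/-- `χ_{∑ x_i} = ∏ χ_{x_i}`. [folklore] -/
lemma charOfWeight_finset_sum (eX : Additive ↥(characterLattice T) ≃+ X) {α : Type*} (s : Finset α)
    (f : α → X) : charOfWeight eX (∑ a ∈ s, f a) = ∏ a ∈ s, charOfWeight eX (f a) := by
  classical
  induction s using Finset.induction_on with
  | empty => simp [charOfWeight]
  | insert a s ha ih => rw [Finset.sum_insert ha, Finset.prod_insert ha, charOfWeight_add', ih]

/-! ### A diagonalising frame and the coordinate weights -/

section Frame

variable [IsAlgClosed k] (hT : IsTorusSubgroup T)

/-- A matrix `g` conjugating the torus `T` into the diagonal matrices (Springer 2.4.2 (ii)). [folklore] -/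
def torusFrame : GL n k := (exists_conj_le_diagonalSubgroup hT.2.1 hT.2.2).choose

/-- `g T g⁻¹` is diagonal. [folklore] -/
lemma torusFrame_spec : T.map (MulAut.conj (torusFrame hT) : GL n k →* GL n k) ≤ diagonalSubgroup n k :=
  (exists_conj_le_diagonalSubgroup hT.2.1 hT.2.2).choose_spec

/-- **The coordinate character** `t ↦ (g t g⁻¹)_{ii}` of `T` (`g = torusFrame`). [folklore] -/
def coordChar (i : n) : ↥T →* kˣ :=
  (diagEntryChar (torusFrame_spec hT) i).comp (conjEquiv (torusFrame hT) T).toMonoidHom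

/-- The coordinate characters are algebraic. [folklore] -/
lemma isAlgebraicChar_coordChar (i : n) : IsAlgebraicChar (coordChar hT i) :=
  (isAlgebraicChar_diagEntryChar (torusFrame_spec hT) i).comp_conjEquiv (torusFrame hT)

/-- The conjugate `g t g⁻¹` is the diagonal matrix of the coordinate characters. [folklore] -/
lemma conj_coe_eq_diagonal (t : ↥T) :
    ((torusFrame hT : GL n k) : Matrix n n k) * ((t : GL n k) : Matrix n n k) *
        (((torusFrame hT)⁻¹ : GL n k) : Matrix n n k) =
      Matrix.diagonal fun i => ((coordChar hT i t : kˣ) : k) := by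
  have e : ((torusFrame hT : GL n k) : Matrix n n k) * ((t : GL n k) : Matrix n n k) *
      (((torusFrame hT)⁻¹ : GL n k) : Matrix n n k) =
      (((conjEquiv (torusFrame hT) T t : ↥(T.map (MulAut.conj (torusFrame hT) : GL n k →* GL n k))) :
        GL n k) : Matrix n n k) := by
    rw [coe_conjEquiv_apply, Units.val_mul, Units.val_mul]
  rw [e]
  ext i j
  rw [coe_apply_diagCoord (torusFrame_spec hT), Matrix.diagonal_apply]
  by_cases hij : i = j
  · subst hij; rw [if_pos rfl, if_pos rfl]; rfl
  · rw [if_neg hij, if_neg hij]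

variable (eX)

/-- **The coordinate weight** `wt_i ∈ X` of the coordinate character. [folklore] -/
def coordWt (i : n) : X := eX (Additive.ofMul ⟨coordChar hT i, isAlgebraicChar_coordChar hT i⟩)

/-- `χ_{wt_i} = coordChar i`. [folklore] -/
lemma charOfWeight_coordWt (i : n) : charOfWeight eX (coordWt eX hT i) = coordChar hT i := by
  simp [coordWt, charOfWeight]

/-- **The coordinate weights generate `X`**: every `x ∈ X` is `∑ m_i wt_i` (every algebraic
character of a diagonal torus is a Laurent monomial in the entries, `exists_diagChar_eq`,
transported along `g`). [cite: SpringerLAG1998, 3.2.3] -/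
theorem exists_sum_coordWt_eq (x : X) : ∃ m : n → ℤ, ∑ i, m i • coordWt eX hT i = x := by
  set χ : ↥(characterLattice T) := Additive.toMul (eX.symm x) with hχ
  obtain ⟨m, hm⟩ := exists_diagChar_eq (torusFrame_spec hT) (χ.2.comp_conjEquiv_symm (torusFrame hT))
  refine ⟨m, ?_⟩
  have key : (∏ i, (⟨coordChar hT i, isAlgebraicChar_coordChar hT i⟩ : ↥(characterLattice T)) ^ m i) = χ := by
    apply Subtype.ext
    rw [SubmonoidClass.coe_finsetProd]
    simp only [SubgroupClass.coe_zpow]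
    refine MonoidHom.ext fun t => ?_
    have e := DFunLike.congr_fun hm (conjEquiv (torusFrame hT) T t)
    rw [MonoidHom.comp_apply, MulEquiv.coe_toMonoidHom, MulEquiv.symm_apply_apply, diagChar_apply] at e
    rw [MonoidHom.finsetProd_apply, ← e]
    simp only [MonoidHom.zpow_apply]
    rfl
  apply eX.symm.injective
  apply Additive.toMul.injective
  rw [← hχ, ← key]
  simp only [map_sum, map_zsmul, coordWt, AddEquiv.symm_apply_apply, toMul_sum, toMul_zsmul, toMul_ofMul]

end Frame

/-! ### Weight classes modulo a lattice, class projectors and class weights -/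

section Classes

variable [IsAlgClosed k] (eX) (hT : IsTorusSubgroup T) (R₀ : Submodule ℤ X)

/-- The class of the coordinate weight `wt_i` modulo `R₀` (the root lattice). [folklore] -/
def wtCls (i : n) : X ⧸ R₀ := Submodule.Quotient.mk (coordWt eX hT i)

open Classical in
/-- The `0/1` diagonal matrix of the class of `i`. [folklore] -/
def classDiag (i : n) : Matrix n n k :=
  Matrix.diagonal fun j => if wtCls eX hT R₀ j = wtCls eX hT R₀ i then (1 : k) else 0

/-- **The class projector** `Π_i = g⁻¹ · 1_{[i]} · g`: the projector of `V = kⁿ` onto the sum of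
the `T`-weight spaces whose weight is congruent to `wt_i` modulo `R₀`, along the others. [folklore] -/
def classProj (i : n) : Matrix n n k :=
  (((torusFrame hT)⁻¹ : GL n k) : Matrix n n k) * classDiag eX hT R₀ i * (torusFrame hT : GL n k)

open Classical in
/-- **The class weight** `λ_i = ∑_{j ∈ [i]} wt_j`. [folklore] -/
def classWt (i : n) : X :=
  ∑ j ∈ Finset.univ.filter (fun j => wtCls eX hT R₀ j = wtCls eX hT R₀ i), coordWt eX hT j

/-- `Π_i` is idempotent. [folklore] -/
lemma classProj_mul_self (i : n) :
    classProj eX hT R₀ i * classProj eX hT R₀ i = classProj eX hT R₀ i := by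
  classical
  unfold classProj classDiag
  exact conj_mul_self_of _ (diagonal_indicator_mul_self _)

/-- **`t ∈ T` commutes with `Π_i`** (`g t g⁻¹` is diagonal). [folklore] -/
theorem classProj_torus_comm (i : n) (t : ↥T) :
    ((t : GL n k) : Matrix n n k) * classProj eX hT R₀ i = classProj eX hT R₀ i * (t : GL n k) := by
  unfold classProj classDiag
  refine mul_conj_comm_of _ ?_
  rw [conj_coe_eq_diagonal, Matrix.diagonal_mul_diagonal, Matrix.diagonal_mul_diagonal]
  congr 1; funext j; rw [mul_comm]

/-- **`projDet Π_i t = χ_{λ_i}(t)` for `t ∈ T`.** [folklore] -/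
theorem projDet_classProj_torus (i : n) (t : ↥T) :
    projDet (classProj eX hT R₀ i) ((t : GL n k) : Matrix n n k) =
      ((charOfWeight eX (classWt eX hT R₀ i) t : kˣ) : k) := by
  classical
  unfold classProj
  rw [projDet_conj, conj_coe_eq_diagonal]
  unfold classDiag
  rw [projDet_diagonal, classWt, charOfWeight_finset_sum, MonoidHom.finsetProd_apply, Units.coe_prod,
    Finset.prod_filter]
  refine Finset.prod_congr rfl fun j _ => ?_
  rw [charOfWeight_coordWt]

/-- **Weight vectors of weights in `R₀` commute with the class projectors**: if
`t A t⁻¹ = χ_x(t) A` with `x ∈ R₀`, then in the diagonal frame a non-zero entry `(g A g⁻¹)_{jl}`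
forces `wt_j - wt_l = x ∈ R₀`, so `A` preserves classes. [folklore] -/
theorem classProj_comm_of_mem_weightSpaceGL {x : X} (hx : x ∈ R₀) {A : Matrix n n k}
    (hA : A ∈ weightSpaceGL T (charOfWeight eX x)) (i : n) :
    A * classProj eX hT R₀ i = classProj eX hT R₀ i * A := by
  classical
  unfold classProj classDiag
  refine mul_conj_comm_of _ (mul_diagonal_comm_of fun j l hB => ?_)
  -- the weight equation in the diagonal frame
  have hentry : ∀ t : ↥T, ((coordChar hT j t : kˣ) : k) *
      (((torusFrame hT : GL n k) : Matrix n n k) * A * (((torusFrame hT)⁻¹ : GL n k) : Matrix n n k)) j l *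
      ((coordChar hT l t⁻¹ : kˣ) : k) =
      ((charOfWeight eX x t : kˣ) : k) *
        (((torusFrame hT : GL n k) : Matrix n n k) * A * (((torusFrame hT)⁻¹ : GL n k) : Matrix n n k)) j l := by
    intro t
    have e := hA t
    rw [← Matrix.coe_units_inv] at e
    have e2 : ((torusFrame hT : GL n k) : Matrix n n k) *
        (((t : GL n k) : Matrix n n k) * A * (((t : GL n k)⁻¹ : GL n k) : Matrix n n k)) *
        (((torusFrame hT)⁻¹ : GL n k) : Matrix n n k) =
        (((torusFrame hT : GL n k) : Matrix n n k) * ((t : GL n k) : Matrix n n k) *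
            (((torusFrame hT)⁻¹ : GL n k) : Matrix n n k)) *
          (((torusFrame hT : GL n k) : Matrix n n k) * A * (((torusFrame hT)⁻¹ : GL n k) : Matrix n n k)) *
          (((torusFrame hT : GL n k) : Matrix n n k) * (((t⁻¹ : ↥T) : GL n k) : Matrix n n k) *
            (((torusFrame hT)⁻¹ : GL n k) : Matrix n n k)) := by
      simp only [Matrix.mul_assoc, coe_inv_mul_cancel_left, Subgroup.coe_inv]
    rw [e, Matrix.mul_smul, Matrix.smul_mul, conj_coe_eq_diagonal hT t, conj_coe_eq_diagonal hT t⁻¹] at e2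
    have e3 := congrFun (congrFun e2 j) l
    rw [Matrix.smul_apply, smul_eq_mul, Matrix.mul_diagonal, Matrix.diagonal_mul] at e3
    exact e3.symm
  -- hence `coordChar j * (coordChar l)⁻¹ = χ_x`, i.e. `wt_j - wt_l = x`
  have hjl : coordWt eX hT j - coordWt eX hT l = x := by
    apply charOfWeight_injective eX
    rw [charOfWeight_sub, charOfWeight_coordWt, charOfWeight_coordWt]
    refine MonoidHom.ext fun t => Units.ext ?_
    have e := hentry t
    rw [map_inv, mul_right_comm] at e
    rw [MonoidHom.mul_apply, MonoidHom.inv_apply, Units.val_mul]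
    exact mul_right_cancel₀ hB e
  have hcls : wtCls eX hT R₀ j = wtCls eX hT R₀ l := by
    rw [wtCls, wtCls, Submodule.Quotient.eq, hjl]; exact hx
  rw [hcls]

end Classes

/-! ### The class weights are orthogonal to the coroots -/

section Coroots

variable [IsMulCommutative ↥T] {eY : Additive ↥(cocharacterLattice T) ≃+ Y}
variable [IsAlgClosed k] [CharZero k] (h : IsRootDatumOf G T P eX eY) (hG : IsAlgebraicSubgroup G)
  (hT : IsTorusSubgroup T)

omit [CharZero k] in
include hT in
/-- The root vector `e_s` is nilpotent. [folklore] -/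
lemma IsRootDatumOf.isNilpotent_rootE (s : ι) : IsNilpotent (h.rootE s) :=
  isNilpotent_of_mem_weightSpaceGL hT.1 (Additive.toMul (eX.symm (P.root s))).2
    (fun h1 => P.ne_zero s (charOfWeight_injective eX (by
      rw [show charOfWeight eX 0 = 1 by simp [charOfWeight]]; exact h1))) (h.rootE_mem s).2

omit [CharZero k] in
include hT in
/-- The root vector `f_s` is nilpotent. [folklore] -/
lemma IsRootDatumOf.isNilpotent_rootF (s : ι) : IsNilpotent (h.rootF s) :=
  isNilpotent_of_mem_weightSpaceGL hT.1 (Additive.toMul (eX.symm (-P.root s))).2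
    (fun h1 => neg_ne_zero.2 (P.ne_zero s) (charOfWeight_injective eX (by
      rw [show charOfWeight eX 0 = 1 by simp [charOfWeight]]; exact h1))) (h.rootF_mem' s).2

include hG hT in
/-- `φ_s (u⁺(x)) = exp (x e_s)`. [cite: SpringerLAG1998, 4.4.9] -/
lemma IsRootDatumOf.coe_rootSL2_upper (s : ι) (x : k) :
    (((h.rootSL2 s (unipotentUpperSL2 (Multiplicative.ofAdd x))) : ↥G) : GL n k) =
      expHom (h.rootE s) (h.isNilpotent_rootE hT s) (Multiplicative.ofAdd x) := by
  have hnil : IsNilpotent (h.isRootHom_rootSL2_upper s).1.velocity := by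
    rw [h.velocity_rootSL2_upper]; exact h.isNilpotent_rootE hT s
  have e := (h.isRootHom_rootSL2_upper s).coe_apply_eq_exp hG hnil x
  rw [MonoidHom.comp_apply] at e
  rw [e]
  exact expHom_congr _ _ (h.velocity_rootSL2_upper s) _

include hG hT in
/-- `φ_s (u⁻(x)) = exp (x f_s)`. [cite: SpringerLAG1998, 4.4.9] -/
lemma IsRootDatumOf.coe_rootSL2_lower (s : ι) (x : k) :
    (((h.rootSL2 s (unipotentLowerSL2 (Multiplicative.ofAdd x))) : ↥G) : GL n k) =
      expHom (h.rootF s) (h.isNilpotent_rootF hT s) (Multiplicative.ofAdd x) := by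
  have hnil : IsNilpotent (h.isRootHom_rootSL2_lower s).1.velocity := by
    rw [h.velocity_rootSL2_lower]; exact h.isNilpotent_rootF hT s
  have e := (h.isRootHom_rootSL2_lower s).coe_apply_eq_exp hG hnil x
  rw [MonoidHom.comp_apply] at e
  rw [e]
  exact expHom_congr _ _ (h.velocity_rootSL2_lower s) _

variable (R₀ : Submodule ℤ X)

include hG in
/-- **`φ_s(SL₂)` commutes with the class projectors and has `projDet Π_i = 1`**, provided
`±α_s ∈ R₀`: `SL₂` is generated by `u^{±}(x)` (`Matrix.SL2.transvection_induction`), which map to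
`exp (x e_s)`, `exp (x f_s)` (`projDet_exp`, `classProj_comm_of_mem_weightSpaceGL`). [folklore] -/
theorem projDet_classProj_rootSL2 (hR : ∀ s, P.root s ∈ R₀) (i : n) (s : ι) (M : SL(2, k)) :
    (((h.rootSL2 s M : ↥G) : GL n k) : Matrix n n k) * classProj eX hT R₀ i =
        classProj eX hT R₀ i * (((h.rootSL2 s M : ↥G) : GL n k) : Matrix n n k) ∧
      projDet (classProj eX hT R₀ i) (((h.rootSL2 s M : ↥G) : GL n k) : Matrix n n k) = 1 := by
  have hQ := classProj_mul_self eX hT R₀ i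
  refine Matrix.SL2.transvection_induction
    (fun M => (((h.rootSL2 s M : ↥G) : GL n k) : Matrix n n k) * classProj eX hT R₀ i =
        classProj eX hT R₀ i * (((h.rootSL2 s M : ↥G) : GL n k) : Matrix n n k) ∧
      projDet (classProj eX hT R₀ i) (((h.rootSL2 s M : ↥G) : GL n k) : Matrix n n k) = 1) ?_ ?_ M
  · refine Fin.forall_fin_two.2 ⟨Fin.forall_fin_two.2 ⟨fun hab => absurd rfl hab, fun hab c => ?_⟩,
      Fin.forall_fin_two.2 ⟨fun hab c => ?_, fun hab => absurd rfl hab⟩⟩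
    · have hc : h.rootE s * classProj eX hT R₀ i = classProj eX hT R₀ i * h.rootE s :=
        classProj_comm_of_mem_weightSpaceGL eX hT R₀ (hR s) (h.rootE_mem s).2 i
      rw [transvection_zero_one, h.coe_rootSL2_upper hG hT, coe_expHom_apply, toAdd_ofAdd]
      exact ⟨exp_smul_comm_of_comm (h.isNilpotent_rootE hT s) hc c,
        projDet_exp hQ (h.isNilpotent_rootE hT s) hc c⟩
    · have hc : h.rootF s * classProj eX hT R₀ i = classProj eX hT R₀ i * h.rootF s :=
        classProj_comm_of_mem_weightSpaceGL eX hT R₀ (R₀.neg_mem (hR s)) (h.rootF_mem' s).2 i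
      rw [transvection_one_zero, h.coe_rootSL2_lower hG hT, coe_expHom_apply, toAdd_ofAdd]
      exact ⟨exp_smul_comm_of_comm (h.isNilpotent_rootF hT s) hc c,
        projDet_exp hQ (h.isNilpotent_rootF hT s) hc c⟩
  · intro A B hA hB
    rw [map_mul, Subgroup.coe_mul, Units.val_mul]
    refine ⟨?_, ?_⟩
    · rw [Matrix.mul_assoc, hB.1, ← Matrix.mul_assoc, hA.1, Matrix.mul_assoc]
    · rw [projDet_mul hQ hB.1, hA.2, hB.2, mul_one]

include h hG in
/-- **`⟨λ_i, α_s^∨⟩ = 0`**: `t ^ ⟨λ_i, α_s^∨⟩ = χ_{λ_i}(α_s^∨(t)) = projDet Π_i (φ_s (diag t)) = 1`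
for all `t ∈ kˣ` (`projDet_classProj_torus`, `projDet_classProj_rootSL2`,
`IsRootDatumOf.charOfWeight_cocharOfCoweight`), and `k` is infinite. [folklore] -/
theorem pairing_classWt_coroot (hR : ∀ s, P.root s ∈ R₀) (i : n) (s : ι) :
    P.toLinearMap (classWt eX hT R₀ i) (P.coroot s) = 0 := by
  have key : ∀ t : kˣ, t ^ (P.toLinearMap (classWt eX hT R₀ i) (P.coroot s)) = 1 := by
    intro t
    rw [← h.charOfWeight_cocharOfCoweight]
    apply Units.ext
    rw [← projDet_classProj_torus eX hT R₀ i, Units.val_one]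
    have e := (projDet_classProj_rootSL2 h hG hT R₀ hR i s (diagSL2 t)).2
    rwa [h.rootSL2_diagSL2, Subgroup.coe_inclusion] at e
  have := zpowGroupHom_units_injective (k := k)
    (a₁ := P.toLinearMap (classWt eX hT R₀ i) (P.coroot s)) (a₂ := 0)
    (MonoidHom.ext fun t => by simpa using key t)
  exact this

end Coroots

/-! ### The lattice lemmas -/

section Lattice

/-- **Extension of `x₀ ↦ 1` killing `N`**: if no non-zero multiple of `x₀` lies in the subgroup
`N ≤ X`, there is an additive map `φ : X → ℚ` with `φ(N) = 0` and `φ(x₀) = 1` (define it on the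
line through the image of `x₀` in `X ⧸ N` and extend by the injectivity of the divisible group `ℚ`,
`Module.Baer.of_divisible`). [folklore] -/
theorem exists_addMonoidHom_eq_one_of_forall_smul_notMem (N : Submodule ℤ X) (x₀ : X)
    (hx : ∀ M : ℤ, M • x₀ ∈ N → M = 0) :
    ∃ φ : X →+ ℚ, (∀ y ∈ N, φ y = 0) ∧ φ x₀ = 1 := by
  have H : ∀ c : ℤ, c • (N.mkQ x₀) = 0 → (RingHom.id ℤ) c • (1 : ℚ) = 0 := by
    intro c hc
    have hc' : N.mkQ (c • x₀) = 0 := by rw [map_zsmul]; exact hc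
    rw [Submodule.mkQ_apply, Submodule.Quotient.mk_eq_zero] at hc'
    rw [hx c hc', RingHom.id_apply, zero_smul]
  have hmem : N.mkQ x₀ ∈ (LinearPMap.mkSpanSingleton' (N.mkQ x₀) (1 : ℚ) H).domain :=
    Submodule.mem_span_singleton_self _
  obtain ⟨ψ, hψ⟩ := (Module.Baer.of_divisible ℚ).extension_property _
    (LinearPMap.mkSpanSingleton' (N.mkQ x₀) (1 : ℚ) H).domain.injective_subtype
    (LinearPMap.mkSpanSingleton' (N.mkQ x₀) (1 : ℚ) H).toFun
  refine ⟨(ψ ∘ₗ N.mkQ).toAddMonoidHom, fun y hy => ?_, ?_⟩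
  · change ψ (N.mkQ y) = 0
    rw [Submodule.mkQ_apply, (Submodule.Quotient.mk_eq_zero N).2 hy, map_zero]
  · change ψ (N.mkQ x₀) = 1
    have e := DFunLike.congr_fun hψ ⟨N.mkQ x₀, hmem⟩
    rw [LinearMap.comp_apply, Submodule.subtype_apply] at e
    rw [e]
    exact LinearPMap.mkSpanSingleton'_apply_self _ (1 : ℚ) H hmem

variable [IsAlgClosed k] (eX) (hT : IsTorusSubgroup T)

/-- **A functional killing the roots and the class weights vanishes**: it is constant on each
class of coordinate weights modulo `ℤR`, `λ_i` is the sum over the class of `i`, a class with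
`#[i] ≥ 1` elements, and the coordinate weights generate `X`. [folklore] -/
theorem addMonoidHom_eq_zero_of_forall_classWt (φ : X →+ ℚ) (hR : ∀ s, φ (P.root s) = 0)
    (hL : ∀ i : n, φ (classWt eX hT (P.rootSpan ℤ) i) = 0) : φ = 0 := by
  classical
  -- `φ` kills the root lattice
  have hR' : ∀ y ∈ P.rootSpan ℤ, φ y = 0 := by
    intro y hy
    have : P.rootSpan ℤ ≤ LinearMap.ker φ.toIntLinearMap := by
      rw [RootPairing.rootSpan, Submodule.span_le]
      rintro _ ⟨s, rfl⟩
      exact hR s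
    exact this hy
  -- `φ` is constant on classes
  have hconst : ∀ i j : n, wtCls eX hT (P.rootSpan ℤ) j = wtCls eX hT (P.rootSpan ℤ) i →
      φ (coordWt eX hT j) = φ (coordWt eX hT i) := by
    intro i j hij
    rw [wtCls, wtCls, Submodule.Quotient.eq] at hij
    have := hR' _ hij
    rwa [map_sub, sub_eq_zero] at this
  -- hence kills every coordinate weight
  have hwt : ∀ i : n, φ (coordWt eX hT i) = 0 := by
    intro i
    have e := hL i
    rw [classWt, map_sum, Finset.sum_congr rfl fun j hj => hconst i j (Finset.mem_filter.1 hj).2,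
      Finset.sum_const, nsmul_eq_mul, mul_eq_zero] at e
    refine e.resolve_left ?_
    rw [Nat.cast_eq_zero]
    exact Finset.card_ne_zero.2 ⟨i, Finset.mem_filter.2 ⟨Finset.mem_univ i, rfl⟩⟩
  -- and the coordinate weights generate `X`
  ext x
  obtain ⟨m, rfl⟩ := exists_sum_coordWt_eq eX hT x
  rw [map_sum, AddMonoidHom.zero_apply]
  exact Finset.sum_eq_zero fun i _ => by rw [map_zsmul, hwt i, smul_zero]

/-- The subgroup `(R^∨)^⊥ = {x | ⟨x, α_s^∨⟩ = 0 ∀ s}` of weights orthogonal to all coroots. [folklore] -/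
def corootOrth (P : RootPairing ι ℤ X Y) : Submodule ℤ X := ⨅ s, LinearMap.ker (P.coroot' s)

omit [Fintype n] [DecidableEq n] [IsAlgClosed k] in
/-- Membership in `(R^∨)^⊥`. [folklore] -/
lemma mem_corootOrth_iff {x : X} : x ∈ corootOrth P ↔ ∀ s, P.toLinearMap x (P.coroot s) = 0 := by
  simp [corootOrth, Submodule.mem_iInf, LinearMap.flip_apply]

omit [Fintype n] [DecidableEq n] [IsAlgClosed k] in
/-- **`ℤR ∩ (R^∨)^⊥ = 0`** (the root form is a sum of squares of the coroot coordinates and is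
anisotropic on `ℤR`, Mathlib `RootPairing.eq_zero_of_mem_rootSpan_of_rootForm_self_eq_zero`).
[folklore] -/
theorem eq_zero_of_mem_rootSpan_of_mem_corootOrth [Finite ι] {x : X} (hx : x ∈ P.rootSpan ℤ)
    (hx' : x ∈ corootOrth P) : x = 0 := by
  cases nonempty_fintype ι
  refine P.eq_zero_of_mem_rootSpan_of_rootForm_self_eq_zero hx ?_
  rw [RootPairing.rootForm_apply_apply]
  exact Finset.sum_eq_zero fun s _ => by
    have hs : P.coroot' s x = 0 := (mem_corootOrth_iff.1 hx') s
    rw [hs, mul_zero]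

/-- **The lattice lemma: every `x ∈ (R^∨)^⊥` has a non-zero multiple in the span `L` of the class
weights**, provided `L ≤ (R^∨)^⊥` (which is `pairing_classWt_coroot`). Otherwise the functional
`0 ⊕ (x ↦ 1)` on `(L + ℤR) ⊕ ℤx` (direct since `ℤR ∩ (R^∨)^⊥ = 0`) extends to `X → ℚ` and
contradicts `addMonoidHom_eq_zero_of_forall_classWt`. [folklore] -/
theorem exists_smul_mem_span_classWt [Finite ι]
    (hLC : ∀ i : n, classWt eX hT (P.rootSpan ℤ) i ∈ corootOrth P) {x : X} (hx : x ∈ corootOrth P) :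
    ∃ M : ℤ, M ≠ 0 ∧ M • x ∈ Submodule.span ℤ (Set.range (classWt eX hT (P.rootSpan ℤ) : n → X)) := by
  set L : Submodule ℤ X := Submodule.span ℤ (Set.range (classWt eX hT (P.rootSpan ℤ) : n → X)) with hLdef
  by_contra hcon
  push Not at hcon
  have hLC' : L ≤ corootOrth P := by
    rw [hLdef, Submodule.span_le]; rintro _ ⟨i, rfl⟩; exact hLC i
  -- no multiple of `x` lies in `N = L + ℤR`
  have hN : ∀ M : ℤ, M • x ∈ L ⊔ P.rootSpan ℤ → M = 0 := by
    intro M hM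
    obtain ⟨l, hl, r, hr, hlr⟩ := Submodule.mem_sup.1 hM
    have hrC : r ∈ corootOrth P := by
      have : r = M • x - l := by rw [← hlr]; abel
      rw [this]
      exact (corootOrth P).sub_mem ((corootOrth P).smul_mem M hx) (hLC' hl)
    have hr0 := eq_zero_of_mem_rootSpan_of_mem_corootOrth hr hrC
    rw [hr0, add_zero] at hlr
    by_contra hM0
    exact hcon M hM0 (hlr ▸ hl)
  obtain ⟨φ, hφN, hφx⟩ := exists_addMonoidHom_eq_one_of_forall_smul_notMem (L ⊔ P.rootSpan ℤ) x hN
  have hφ0 : φ = 0 := addMonoidHom_eq_zero_of_forall_classWt eX hT φ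
    (fun s => hφN _ (Submodule.mem_sup_right (Submodule.subset_span ⟨s, rfl⟩)))
    (fun i => hφN _ (Submodule.mem_sup_left (Submodule.subset_span ⟨i, rfl⟩)))
  rw [hφ0, AddMonoidHom.zero_apply] at hφx
  exact zero_ne_one hφx

omit [Fintype n] [DecidableEq n] [IsAlgClosed k] in
/-- **Two-group combination.** Let `R, L, L', C ≤ X` with `L ≤ C`, every element of `C` having a
non-zero multiple in `L'`, and such that a functional `X → ℚ` killing `R` and `L` vanishes. Then every
`x ∈ X` has a non-zero multiple in `R + L ∩ L'`. (Applied with `R = ℤR`, `C = (R^∨)^⊥` and the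
class-weight lattices `L, L'` of two groups with the same root datum.) [folklore] -/
theorem exists_smul_mem_sup_inf (R L L' C : Submodule ℤ X) (hLC : L ≤ C)
    (hL' : ∀ x ∈ C, ∃ M : ℤ, M ≠ 0 ∧ M • x ∈ L')
    (hF : ∀ φ : X →+ ℚ, (∀ y ∈ R, φ y = 0) → (∀ y ∈ L, φ y = 0) → φ = 0) (x : X) :
    ∃ M : ℤ, M ≠ 0 ∧ M • x ∈ R ⊔ L ⊓ L' := by
  by_contra hcon
  push Not at hcon
  have hN : ∀ M : ℤ, M • x ∈ R ⊔ L ⊓ L' → M = 0 := fun M hM => by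
    by_contra hM0; exact hcon M hM0 hM
  obtain ⟨φ, hφN, hφx⟩ := exists_addMonoidHom_eq_one_of_forall_smul_notMem _ x hN
  have hφ0 : φ = 0 := by
    refine hF φ (fun y hy => hφN y (Submodule.mem_sup_left hy)) fun y hy => ?_
    obtain ⟨M, hM0, hM⟩ := hL' y (hLC hy)
    have e := hφN (M • y) (Submodule.mem_sup_right ⟨L.smul_mem M hy, hM⟩)
    rw [map_zsmul, smul_eq_zero] at e
    exact e.resolve_left hM0
  rw [hφ0, AddMonoidHom.zero_apply] at hφx
  exact zero_ne_one hφx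

end Lattice

end Literature.NumberTheory.Automorphic

end
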